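import Summits.CriticalPhenomena.PercolationContinuityZ3.Theorems.PercNearOneGluingNoHeavyLowerTailSunflowerC1SplittingCertificate
import HarnessLib

/-!
# `NoHeavyLowerTail` (crux stmt-CriticalPhenomena-4575), abstract sunflower cubic: (C1) AT EVERY BIAS for the three PERCOLATION SUNFLOWERS OF `K₄`
# (compiled canonical-splitting certificates) — structure `k4pair`

Support file (seat `prim-ineq-gen-2` gen 34; `--supports stmt-CriticalPhenomena-4575`; `--computational`: `native_decide` evaluations of
`C1Cert.checkSplit` (…SunflowerC1SplittingCertificate) and of the decidable structure axioms; nothing else is computed).  No `sorry`, no named facts.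
Memo: run/shared/lean/prim/prim-ineq-gen-2/RECURSIVE-SPLITTING-GEN34.md; structures = gen 33's `perc_structs` (HOME/gen33/py/perc_structs.py).

These are the sunflowers the lineage's cubic came from: bond percolation on the complete graph `K₄` with an ARBITRARY probability per edge (six
coins), three terminal events forming a sunflower of up-sets.  For each, (C1) `c₁c₂c₃ ≤ max(a,b)·(ab − (c₁c₂+c₁c₃+c₂c₃))` holds for the cell masses
at every bias vector — e.g. for `k4conn`: `a = P(0,1,2 all connected)`, `b = P(0,1,2 pairwise separated)`, `c_i = P(exactly the two terminals other than i
are joined)`, for every assignment of open-probabilities to the six edges of `K₄`.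
* `k4iso`  — terminals a,b,c = vertices 0,1,2 of K₄, coins = the 6 edges read as CLOSED (x_e = probability that e is closed): E_i = {terminal i isolated from the other two}, core = all three separated, petal i = {i isolated, the other two joined}, bottom = no terminal isolated (cells [42, 6, 6, 6, 4]);
* `k4pair` — terminals = all 4 vertices, coins = closed edges: E_i = {clusters refine the i-th pairing}, core = all four separated (cells [54, 3, 3, 3, 1]);
* `k4conn` — terminals 0,1,2, coins = the 6 edges read as OPEN: E_i = {the other two terminals are connected}, core = all three connected, petal i = {exactly the pair not containing i joined}, bottom = all separated (cells [4, 6, 6, 6, 42]).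
-/

namespace Summit.CriticalPhenomena.PercolationContinuityZ3.Theorems.SunflowerPartition

namespace SafeCalc

namespace C1Cert

open Finset Bern

/-- The percolation sunflower `k4pair` of `K₄`: terminals = all 4 vertices, coins = closed edges: E_i = {clusters refine the i-th pairing}, core = all four separated; the three up-sets `E₁, E₂, E₃` as families of edge sets (edges
`0..5` of `K₄` in the order 01,02,03,12,13,23). [this work] -/
def k4pairV : Fin 3 → Finset (Finset (Fin 6)) :=
  ![{{1, 2, 3, 4}, {0, 1, 2, 3, 4}, {1, 2, 3, 4, 5}, {0, 1, 2, 3, 4, 5}},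
    {{0, 2, 3, 5}, {0, 1, 2, 3, 5}, {0, 2, 3, 4, 5}, {0, 1, 2, 3, 4, 5}},
    {{0, 1, 4, 5}, {0, 1, 2, 4, 5}, {0, 1, 3, 4, 5}, {0, 1, 2, 3, 4, 5}}]

/-- The sunflower `k4pair` (axioms by compiled decision). [this work] -/
def k4pair : Sunflower (Fin 6) :=
  ⟨k4pairV, fun i => isUpperSet_of_insert_mem (by revert i; native_decide), by native_decide⟩

/-- The canonical Gladkov splitting certifies `k4pair` (compiled check). [this work] -/
theorem k4pair_split : checkSplit k4pair = true := by native_decide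

/-- **(C1) for `k4pair` at every bias** `x ∈ [0,1]^6`. [this work] -/
theorem k4pair_C1 (x : Fin 6 → ℝ) (hx : ∀ i, 0 ≤ x i ∧ x i ≤ 1) :
    cellMass k4pair 1 x * cellMass k4pair 2 x * cellMass k4pair 3 x ≤
      max (cellMass k4pair 4 x) (cellMass k4pair 0 x) *
        (cellMass k4pair 4 x * cellMass k4pair 0 x
          - (cellMass k4pair 1 x * cellMass k4pair 2 x + cellMass k4pair 1 x * cellMass k4pair 3 x + cellMass k4pair 2 x * cellMass k4pair 3 x)) :=
  c1_of_checkSplit k4pair k4pair_split x hx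

end C1Cert

end SafeCalc

end Summit.CriticalPhenomena.PercolationContinuityZ3.Theorems.SunflowerPartition
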